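import Literature.Computability.QuantumComplexity.ZXCalculusQuotient
import HarnessLib

/-!
# `ZX_{π/4}` modulo the calculus: crossings of one wire over a block

Topic `Literature/Computability/QuantumComplexity`, continuing `ZXCalculusQuotient.lean` (layer A3 of
the formalisation of `JeandelPerdrixVilmart2018_completeness`). The rule table of `ZXCalculus.lean`
presents the symmetry of the PROP of diagrams by the crossing `σ` and ONE naturality axiom,
`Rule.swap_nat : (A ⊗ 𝕀) ⨾ χₘ = χₙ ⨾ (𝕀 ⊗ A)` for the crossing `χₙ = bswap1 n : (n + 1) → (1 + n)`
of the last wire over a block of `n` wires. Here we derive the rest of the symmetric structure on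
one wire (Selinger 2010, §3.3–3.5; Lafont's presentation of permutations):

* `ZXDiagram.fswap1 n : (1 + n) → (n + 1)`, the first wire crossing over the block (the upside-down
  flip of `bswap1 n`), with the unfolding lemmas `bswap1_succ`, `fswap1_succ`, `bswap1_one`,
  `fswap1_one`, `bswap1_two`;
* `χ` and its flip are mutually inverse modulo the calculus: `bswap1_seq_fswap1`,
  `fswap1_seq_bswap1` (induction on the block, from `σσ = 𝕀` and interchange);
* naturality of the flip `fswap1_nat` (the flip of `swap_nat`), and the conjugation forms
  `wires_par_eq_conj`, `par_wires_eq_conj` expressing `𝕀 ⊗ A` through `A ⊗ 𝕀` and crossings;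
* the Yang–Baxter equation `yang_baxter` (naturality of `χ₂` at `A = σ`).

## References

* P. Selinger, *A survey of graphical languages for monoidal categories* (2010), §3.3–3.5
  [Selinger2010].
* E. Jeandel, S. Perdrix, R. Vilmart, LICS 2018 (arXiv:1705.11151v2), §2.2 ("only topology
  matters") [JeandelPerdrixVilmart2018].
-/

noncomputable section

namespace Literature.Computability.QuantumComplexity

open ZXDiagram ZXClass

variable {n m k n' m' : ℕ}

namespace ZXDiagram

/-- The crossing of the FIRST wire over a block of `n` wires, `(1 + n) → (n + 1)`: the upside-down
flip of `bswap1 n` (which crosses the last wire over the block). [folklore] -/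
def fswap1 (n : ℕ) : ZXDiagram (1 + n) (n + 1) := (bswap1 n).transpose

/-- No block: `χ₀ = 𝕀`. [folklore] -/
@[simp] theorem bswap1_zero : bswap1 0 = wires 1 := rfl

/-- Unfolding `χₙ₊₁`: cross the last two wires, then cross over the remaining block. [folklore] -/
theorem bswap1_succ (n : ℕ) : bswap1 (n + 1) = ((wires n ⊗ swap) ⨾ (bswap1 n ⊗ wires 1)) := rfl

/-- No block: the flip of `χ₀` is `𝕀`. [folklore] -/
@[simp] theorem fswap1_zero : fswap1 0 = wires 1 := rfl

/-- Unfolding the flip of `χₙ₊₁`. [folklore] -/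
theorem fswap1_succ (n : ℕ) : fswap1 (n + 1) = ((fswap1 n ⊗ wires 1) ⨾ (wires n ⊗ swap)) := rfl

/-- The flip of `bswap1` is `fswap1` (definitional). [folklore] -/
@[simp] theorem transpose_bswap1 (n : ℕ) : (bswap1 n).transpose = fswap1 n := rfl

/-- The flip of `fswap1` is `bswap1`. [folklore] -/
@[simp] theorem transpose_fswap1 (n : ℕ) : (fswap1 n).transpose = bswap1 n := transpose_transpose _

/-- `bswap1` has no colours. [folklore] -/
@[simp] theorem colorSwap_bswap1 : (n : ℕ) → (bswap1 n).colorSwap = bswap1 n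
  | 0 => rfl
  | n + 1 => by rw [bswap1_succ, colorSwap_seq, colorSwap_par, colorSwap_par, colorSwap_bswap1 n]; rfl

/-- `fswap1` has no colours. [folklore] -/
@[simp] theorem colorSwap_fswap1 : (n : ℕ) → (fswap1 n).colorSwap = fswap1 n
  | 0 => rfl
  | n + 1 => by rw [fswap1_succ, colorSwap_seq, colorSwap_par, colorSwap_par, colorSwap_fswap1 n]; rfl

end ZXDiagram

namespace ZXClass

/-! ### Small blocks -/

/-- `χ₁ = σ` modulo the calculus. [folklore] -/
@[simp] theorem bswap1_one : mk (bswap1 1) = mk swap := by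
  rw [bswap1_succ, bswap1_zero, ← mk_seq_mk, ← mk_par_mk, ← mk_par_mk, empty_par, cast_id,
    wires_par_wires, seq_id]

/-- The flip of `χ₁` is `σ` modulo the calculus. [folklore] -/
@[simp] theorem fswap1_one : mk (fswap1 1) = mk swap := by
  rw [← transpose_bswap1, ← transpose_mk, bswap1_one]; rfl

/-- `χ₂ = (𝕀 ⊗ σ) ⨾ (σ ⊗ 𝕀)` modulo the calculus. [folklore] -/
theorem bswap1_two : mk (bswap1 2) = (mk (wires 1) ⊠ mk swap) ⨟ (mk swap ⊠ mk (wires 1)) := by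
  rw [bswap1_succ, ← mk_seq_mk, ← mk_par_mk, ← mk_par_mk, bswap1_one]

/-- The flip of `χ₂` is `(σ ⊗ 𝕀) ⨾ (𝕀 ⊗ σ)` modulo the calculus. [folklore] -/
theorem fswap1_two : mk (fswap1 2) = (mk swap ⊠ mk (wires 1)) ⨟ (mk (wires 1) ⊠ mk swap) := by
  rw [fswap1_succ, ← mk_seq_mk, ← mk_par_mk, ← mk_par_mk, fswap1_one]

/-! ### `χ` and its flip are mutually inverse -/

/-- Two crossings side by side undo each other: `(𝕀ⁿ ⊗ σ) ⨾ (𝕀ⁿ ⊗ σ) = 𝕀ⁿ⁺²`. [folklore] -/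
theorem wires_par_swap_seq_self (n : ℕ) :
    (mk (wires n) ⊠ mk swap) ⨟ (mk (wires n) ⊠ mk swap) = mk (wires (n + 2)) := by
  rw [interchange, id_seq, swap_seq_swap, wires_par_wires]

/-- `χₙ` followed by its flip is the identity. [folklore] -/
@[simp] theorem bswap1_seq_fswap1 : (n : ℕ) → mk (bswap1 n) ⨟ mk (fswap1 n) = mk (wires (n + 1))
  | 0 => by simp
  | n + 1 => by
      rw [bswap1_succ, fswap1_succ]
      simp only [← mk_seq_mk, ← mk_par_mk]
      rw [seq_assoc, ← seq_assoc (mk (bswap1 n) ⊠ mk (wires 1)), interchange, bswap1_seq_fswap1 n,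
        id_seq, wires_par_wires, id_seq, wires_par_swap_seq_self]

/-- The flip of `χₙ` followed by `χₙ` is the identity. [folklore] -/
@[simp] theorem fswap1_seq_bswap1 : (n : ℕ) → mk (fswap1 n) ⨟ mk (bswap1 n) = mk (wires (1 + n))
  | 0 => by simp
  | n + 1 => by
      rw [bswap1_succ, fswap1_succ]
      simp only [← mk_seq_mk, ← mk_par_mk]
      rw [seq_assoc, ← seq_assoc (mk (wires n) ⊠ mk swap), wires_par_swap_seq_self, id_seq,
        interchange, fswap1_seq_bswap1 n, id_seq, wires_par_wires]
      rfl

/-! ### Naturality -/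

/-- Naturality of the flip: `χ'ₙ ⨾ (A ⊗ 𝕀) = (𝕀 ⊗ A) ⨾ χ'ₘ` (the upside-down flip of `swap_nat`).
[folklore] -/
theorem fswap1_nat (A : ZXClass n m) :
    mk (fswap1 n) ⨟ (A ⊠ mk (wires 1)) = (mk (wires 1) ⊠ A) ⨟ mk (fswap1 m) := by
  have h := congrArg transpose (swap_nat A.transpose)
  simpa using h

/-- `𝕀 ⊗ A` is `A ⊗ 𝕀` conjugated by the crossings: `𝕀 ⊗ A = χ'ₙ ⨾ (A ⊗ 𝕀) ⨾ χₘ`. [folklore] -/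
theorem wires_par_eq_conj (A : ZXClass n m) :
    mk (wires 1) ⊠ A = mk (fswap1 n) ⨟ (A ⊠ mk (wires 1)) ⨟ mk (bswap1 m) := by
  rw [fswap1_nat, seq_assoc, fswap1_seq_bswap1, seq_id]

/-- `A ⊗ 𝕀` is `𝕀 ⊗ A` conjugated by the crossings: `A ⊗ 𝕀 = χₙ ⨾ (𝕀 ⊗ A) ⨾ χ'ₘ`. [folklore] -/
theorem par_wires_eq_conj (A : ZXClass n m) :
    A ⊠ mk (wires 1) = mk (bswap1 n) ⨟ (mk (wires 1) ⊠ A) ⨟ mk (fswap1 m) := by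
  rw [← swap_nat, seq_assoc, bswap1_seq_fswap1, seq_id]

/-- Naturality of `χ`, solved for the block on the other side: `χ'ₙ… `: `(𝕀 ⊗ A) ⨾ χ'ₘ ⨾ … `; precisely
`(𝕀 ⊗ A) = χ'ₙ ⨾ (A ⊗ 𝕀) ⨾ χₘ` read as `χₙ ⨾ (𝕀 ⊗ A) = (A ⊗ 𝕀) ⨾ χₘ`. [folklore] -/
theorem bswap1_seq_wires_par (A : ZXClass n m) :
    mk (bswap1 n) ⨟ (mk (wires 1) ⊠ A) = (A ⊠ mk (wires 1)) ⨟ mk (bswap1 m) := (swap_nat A).symm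

/-- The flip of naturality, solved the other way: `(A ⊗ 𝕀) ⨾ … `: `χ'ₙ ⨾ (A ⊗ 𝕀) ⨾ χₘ = 𝕀 ⊗ A`.
[folklore] -/
theorem wires_par_seq_fswap1 (A : ZXClass n m) :
    (mk (wires 1) ⊠ A) ⨟ mk (fswap1 m) = mk (fswap1 n) ⨟ (A ⊠ mk (wires 1)) := (fswap1_nat A).symm

/-! ### Yang–Baxter -/

/-- **The Yang–Baxter equation** `(σ ⊗ 𝕀)(𝕀 ⊗ σ)(σ ⊗ 𝕀) = (𝕀 ⊗ σ)(σ ⊗ 𝕀)(𝕀 ⊗ σ)`: naturality of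
`χ₂` with respect to `σ` itself. [folklore] -/
theorem yang_baxter :
    (mk swap ⊠ mk (wires 1)) ⨟ (mk (wires 1) ⊠ mk swap) ⨟ (mk swap ⊠ mk (wires 1)) =
      (mk (wires 1) ⊠ mk swap) ⨟ (mk swap ⊠ mk (wires 1)) ⨟ (mk (wires 1) ⊠ mk swap) := by
  have h := swap_nat (mk swap)
  rw [bswap1_two, ← seq_assoc] at h
  exact h

end ZXClass

end Literature.Computability.QuantumComplexity
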